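import Literature.Analysis.SpecialFunctions.RiemannThetaCharacteristics
import HarnessLib

/-!
# Koizumi's generalized addition formula: the multiplication table of theta functions with
# characteristics at levels `α` and `β`

Layer `Literature/Analysis/SpecialFunctions`, namespace `Literature.Analysis.SpecialFunctions`; lane
`lit-hodgefound` (Layer A2, seat `lit-hodgefound-skel-2`, generation 19), row **A2-75**, FILE 1 of the row
«projective normality of complex abelian varieties after Koizumi (1975/76): the graded algebra
`⊕_α Θ_α((z, e), m)` of classical theta functions, `Θ_{α+β} = Θ_α · Θ_β` for `α ≥ 2`, `β ≥ 3`».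
THEOREMS ONLY (no definition, no named fact, no `sorry`).

Source followed: S. Koizumi, *On the structure of the graded ℂ-algebras of theta functions*, Proc. Japan
Acad. **51** (1975) 325–328 (key `Koizumi1975GradedAlgebrasTheta`; open access, held as
`paper:galaxy-pdf-7080252123399715800`, chunks p0001–p0005) — the announcement, with statements, of
S. Koizumi, *Theta relations and projective normality of abelian varieties*, Amer. J. Math. **98** (1976)
865–889 (key `Koizumi1976ThetaRelations`; not held, acq-10299). VERBATIM [p0001–p0002]:

> "`θ[k](z | x)` is a holomorphic function on `(z, x) ∈ ℌ_n × ℂ^n`, which is defined by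
> `θ[k](z | x) = Σ_{r ∈ ℤ^n} e{½ ᵗ(r + k₁) z (r + k₁) + ᵗ(r + k₁)(x + k₂)}`" (`e(t) = exp(2π√−1 t)`,
> `k = (k₁; k₂) ∈ ℝ^{2n}`) […] "**2. Generalized addition formulas.** The following formula which is
> proved just by means of computation of the series, is fundamental in the approach to all our process.
> **Theorem 2** (Generalized addition formulas). For `k⁽¹⁾, k⁽²⁾ ∈ ℝ^{2n}`, and `α, β, γ ∈ ℤ₊` such
> that `α` is divisible by `γ`, we have
> (2.a) `θ[k⁽¹⁾](αz | αx⁽¹⁾) · θ[k⁽²⁾](βz | βx⁽²⁾)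
>  = Σ_{p₁ ∈ U_{α+β}} { Σ_{c₁ ∈ U_γ} θ[γ⁻¹(α+β)⁻¹(αk₁⁽¹⁾ + βk₁⁽²⁾) + γ⁻¹αp₁ + c₁ ; γ(k₂⁽¹⁾ + k₂⁽²⁾)]
>      (γ²(α+β)z | γ(αx⁽¹⁾ + βx⁽²⁾)) }
>    × θ[(α+β)⁻¹(−k₁⁽¹⁾ + k₁⁽²⁾) − p₁ ; −βk₂⁽¹⁾ + αk₂⁽²⁾](αβ(α+β)z | αβ(−x⁽¹⁾ + x⁽²⁾))`.
> The following (2.b) follows easily from (2.a) by simple substitutions (especially `γ = 1` etc.).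
> **Corollary 2.1.** For `k ∈ ℝ^{2n}`; `α, β ∈ ℤ₊`; and `(a₁, b₁) ∈ U_{αe} × U_{βe}`, we have
> (2.b) `θ[k₁ + a₁; αk₂](αz | αx) · θ[k₁ + b₁; βk₂](βz | βx)
>  = Σ_{p₁ ∈ U_{α+β}} θ[k₁ + (α+β)⁻¹(αa₁ + βb₁) + αp₁; (α+β)k₂]((α+β)z | (α+β)x)
>    × θ[(α+β)⁻¹(−a₁ + b₁) − p₁; 0](αβ(α+β)z | 0)`.
> We content ourselves with stating this formula (2.b) as an answer to the question (b) at this moment."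

(`U_α` = "a complete set of representatives of `α⁻¹ℤ^n mod ℤ^n`", [p0001].)

## Dictionary

* Koizumi's `θ[k](z | x)`, `k = (k₁; k₂)`, IS the tree's `riemannThetaChar k₁ k₂ z x`
  (`RiemannThetaCharacteristics.lean`: `Σ_m exp(πi ᵗ(m+a)Ω(m+a) + 2πi ᵗ(m+a)(z+b))`), same
  normalisation; characteristics are allowed to be complex (every identity below is
  polynomial–exponential in them), `Ω` (= Koizumi's `z`) is symmetric with `Im Ω ≥ c > 0`.
* `U_{α+β} ∋ p₁ = p/(α+β)` with `p ∈ {0, …, α+β−1}^g` = `Fin g → Fin (α + β)`; "`+ αp₁`" is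
  `+ αp/(α+β)` inside the factor `(α+β)⁻¹ • (…)`, "`− p₁`" is `− p/(α+β)`; likewise `U_γ ∋ c₁ = k/γ`.

## Contents (all theorems)

* §1 `dotProduct_mulVec_weighted_add_weighted_sub`, `dotProduct_weighted_add_weighted_sub` — the two
  algebraic identities of the "computation of the series": `α ᵗuΩu + β ᵗvΩv = (α+β)⁻¹[ᵗwΩw + αβ ᵗdΩd]`
  with `w = αu + βv`, `d = v − u` (valid for ANY bilinear pairing), and its linear companion.
* §2 `mulIndex_bijective` — the reindexing `(p, m, m′) ↦ (r, s) = (m − βm′ + p, m + αm′)`,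
  a bijection `{0,…,α+β−1}^g × ℤ^g × ℤ^g ≃ ℤ^g × ℤ^g` (for `α = β = 1` the level-two reindexing of
  `RiemannThetaLevelTwo.lean`).
* §3 `riemannThetaCharTerm_mul_riemannThetaCharTerm` — the general terms multiply accordingly.
* §4 `smul_im_bound`, `summable_norm_riemannThetaCharTerm_smul` (convergence at `kΩ`, `k > 0`) and the
  abstract Fubini/reindexing steps `tsum_mul_tsum_eq_sum_of_reindex`, `tsum_eq_sum_tsum_of_reindex`.
* §5 **`riemannThetaChar_mul_riemannThetaChar`** — (2.a) at `γ = 1` for ALL complex characteristics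
  `(a₁; b₁)`, `(a₂; b₂)` and arguments `x, y`:
  `ϑ[a₁;b₁](αΩ, αx) ϑ[a₂;b₂](βΩ, βy) = Σ_p ϑ[(αa₁+βa₂+αp)/(α+β); b₁+b₂]((α+β)Ω, αx+βy)
  · ϑ[(a₂−a₁−p)/(α+β); αb₂−βb₁](αβ(α+β)Ω, αβ(y−x))`.
* §6 `levelIndex_bijective`, `riemannThetaCharTerm_level`, **`riemannThetaChar_eq_sum_level`** —
  `ϑ[a;b](Ω, z) = Σ_{k ∈ {0,…,γ−1}^g} ϑ[(a+k)/γ; γb](γ²Ω, γz)` (the inner sum over `c₁ ∈ U_γ`).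
* §7 **`riemannThetaChar_mul_riemannThetaChar_koizumi`** = (2.b) as printed, and
  **`riemannThetaChar_mul_riemannThetaChar_level`** = (2.a) with the `U_γ`-sum (the printed proviso
  "`α` divisible by `γ`" is not needed for the identity; Koizumi uses it for the types of the factors).

NOT in this file (the next files of row A2-75): Prop. 1 (the base theorem — the tree's
`typeDThetaBasis` of `RiemannThetaCharBasis.lean` is its `α = 1` case), Thm. 3 (the rank theorem),
Lemmas 4.1/4.2, Thm. 4.3 (the surjection theorem), Thm. 5.1 (`Θ_{α+β} = Θ_α·Θ_β` for `α ≥ 2, β ≥ 3`)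
and Cor. 5.2/5.3 (projective normality of `(X, L^γ)`, `γ ≥ 3`).

## References

* [Koizumi1975GradedAlgebrasTheta] S. Koizumi, On the structure of the graded ℂ-algebras of theta
  functions, Proc. Japan Acad. 51 (1975) 325–328, §2 Thm. 2 (2.a), Cor. 2.1 (2.b) (chunks p0001–p0002).
* [Koizumi1976ThetaRelations] S. Koizumi, Theta relations and projective normality of abelian
  varieties, Amer. J. Math. 98 (1976) 865–889, §2.
* [MumfordTata1] D. Mumford, Tata Lectures on Theta I (1983), Ch. II §1 and §6 (Riemann's theta
  formula; the case `α = β = 1` of the reindexing).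
* [LangeBirkenhake1992] H. Lange, Ch. Birkenhake, Complex Abelian Varieties, §3.3.2 Prop. 3.3.6
  (absolute convergence).
-/

noncomputable section

open Complex Real Finset Filter Topology Matrix

namespace Literature.Analysis.SpecialFunctions

variable {g : ℕ}

/-! ### §1 The algebra of the exponents -/

/-- **The quadratic identity behind every theta multiplication formula**: for ANY bilinear pairing
(no symmetry needed) `ᵗ(αU+βV)Ω(αU+βV) + αβ ᵗ(V−U)Ω(V−U) = (α+β)(α ᵗUΩU + β ᵗVΩV)`. [folklore] -/
private theorem dotProduct_mulVec_weighted_add_weighted_sub (Ω : Matrix (Fin g) (Fin g) ℂ)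
    (U V : Fin g → ℂ) (α β : ℂ) :
    (α • U + β • V) ⬝ᵥ (Ω *ᵥ (α • U + β • V)) + α * β * ((V - U) ⬝ᵥ (Ω *ᵥ (V - U))) =
      (α + β) * (α * (U ⬝ᵥ (Ω *ᵥ U)) + β * (V ⬝ᵥ (Ω *ᵥ V))) := by
  simp only [add_dotProduct, dotProduct_add, sub_dotProduct, dotProduct_sub, Matrix.mulVec_add,
    Matrix.mulVec_sub, smul_dotProduct, dotProduct_smul, Matrix.mulVec_smul, smul_eq_mul]
  ring

/-- **The linear identity**: `ᵗ(αU+βV)(αx+βy+b₁+b₂) + ᵗ(V−U)(αβ(y−x) + αb₂ − βb₁)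
= (α+β)(ᵗU(αx+b₁) + ᵗV(βy+b₂))`. [folklore] -/
private theorem dotProduct_weighted_add_weighted_sub (U V x y b₁ b₂ : Fin g → ℂ) (α β : ℂ) :
    (α • U + β • V) ⬝ᵥ (α • x + β • y + (b₁ + b₂)) +
        (V - U) ⬝ᵥ ((α * β) • (y - x) + (α • b₂ - β • b₁)) =
      (α + β) * (U ⬝ᵥ (α • x + b₁) + V ⬝ᵥ (β • y + b₂)) := by
  simp only [add_dotProduct, dotProduct_add, sub_dotProduct, dotProduct_sub, smul_dotProduct,
    dotProduct_smul, smul_eq_mul]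
  ring

/-! ### §2 The reindexing bijection `(p, m, m′) ↦ (m − βm′ + p, m + αm′)` -/

/-- **`(p, m, m′) ↦ (r, s) = (m − βm′ + p, m + αm′)` is a bijection
`{0,…,α+β−1}^g × ℤ^g × ℤ^g ≃ ℤ^g × ℤ^g`** (inverse: `p = (r − s) mod (α+β)`,
`m′ = −⌊(r − s)/(α+β)⌋`, `m = s − αm′`); for `α = β = 1` this is the level-two reindexing
`(c, q, u) ↦ (q + c − u, u + q)`. [folklore] -/
private theorem mulIndex_bijective (g : ℕ) {α β : ℕ} (hn : 0 < α + β) :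
    Function.Bijective (fun x : (Fin g → Fin (α + β)) × (Fin g → ℤ) × (Fin g → ℤ) =>
      ((fun i => x.2.1 i - (β : ℤ) * x.2.2 i + ((x.1 i : ℕ) : ℤ),
        fun i => x.2.1 i + (α : ℤ) * x.2.2 i) : (Fin g → ℤ) × (Fin g → ℤ))) := by
  have hn0 : (0 : ℤ) < ((α + β : ℕ) : ℤ) := by exact_mod_cast hn
  have hne : ((α + β : ℕ) : ℤ) ≠ 0 := hn0.ne'
  have hsum : ((α + β : ℕ) : ℤ) = (α : ℤ) + (β : ℤ) := by push_cast; ring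
  refine Function.bijective_iff_has_inverse.mpr ⟨fun y =>
    (fun i => ⟨((y.1 i - y.2 i) % ((α + β : ℕ) : ℤ)).toNat, ?_⟩,
      fun i => y.2 i + (α : ℤ) * ((y.1 i - y.2 i) / ((α + β : ℕ) : ℤ)),
      fun i => -((y.1 i - y.2 i) / ((α + β : ℕ) : ℤ))), ?_, ?_⟩
  · have h0 := Int.emod_nonneg (y.1 i - y.2 i) hne
    have h1 := Int.emod_lt_of_pos (y.1 i - y.2 i) hn0
    omega
  · rintro ⟨p, m, m'⟩
    have key : ∀ i, (m i - (β : ℤ) * m' i + ((p i : ℕ) : ℤ)) - (m i + (α : ℤ) * m' i) =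
        ((p i : ℕ) : ℤ) + ((α + β : ℕ) : ℤ) * (-(m' i)) := by
      intro i
      rw [hsum]
      ring
    have hp : ∀ i, (0 : ℤ) ≤ ((p i : ℕ) : ℤ) ∧ ((p i : ℕ) : ℤ) < ((α + β : ℕ) : ℤ) := fun i =>
      ⟨by positivity, by exact_mod_cast (p i).isLt⟩
    have hdiv : ∀ i, ((m i - (β : ℤ) * m' i + ((p i : ℕ) : ℤ)) - (m i + (α : ℤ) * m' i)) /
        ((α + β : ℕ) : ℤ) = -(m' i) := by
      intro i
      rw [key i, Int.add_mul_ediv_left _ _ hne, Int.ediv_eq_zero_of_lt (hp i).1 (hp i).2, zero_add]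
    have hmod : ∀ i, ((m i - (β : ℤ) * m' i + ((p i : ℕ) : ℤ)) - (m i + (α : ℤ) * m' i)) %
        ((α + β : ℕ) : ℤ) = ((p i : ℕ) : ℤ) := by
      intro i
      rw [key i, Int.add_mul_emod_self_left, Int.emod_eq_of_lt (hp i).1 (hp i).2]
    simp only [Prod.mk.injEq]
    refine ⟨funext fun i => Fin.ext ?_, funext fun i => ?_, funext fun i => ?_⟩
    · simp only [hmod i, Int.toNat_natCast]
    · rw [hdiv i]
      ring
    · rw [hdiv i]
      ring
  · rintro ⟨r, s⟩
    simp only [Prod.mk.injEq]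
    refine ⟨funext fun i => ?_, funext fun i => ?_⟩
    · have h0 := Int.emod_nonneg (r i - s i) hne
      have h := Int.mul_ediv_add_emod (r i - s i) ((α + β : ℕ) : ℤ)
      rw [Int.toNat_of_nonneg h0]
      linear_combination h - ((r i - s i) / ((α + β : ℕ) : ℤ)) * hsum
    · ring

/-! ### §3 The pointwise identity of general terms -/

/-- Cast of the first new index: `r = m − βm′ + p` as a complex vector. [folklore] -/
private theorem intCast_vec_mulIndex₁ {α β : ℕ} (p : Fin g → Fin (α + β)) (m m' : Fin g → ℤ) :
    (fun i => (((fun i => m i - (β : ℤ) * m' i + ((p i : ℕ) : ℤ)) i : ℤ) : ℂ)) =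
      (fun i => (m i : ℂ)) - (β : ℂ) • (fun i => (m' i : ℂ)) + fun i => ((p i : ℕ) : ℂ) := by
  funext i
  simp only [Pi.add_apply, Pi.sub_apply, Pi.smul_apply, smul_eq_mul]
  push_cast
  ring

/-- Cast of the second new index: `s = m + αm′` as a complex vector. [folklore] -/
private theorem intCast_vec_mulIndex₂ {α : ℕ} (m m' : Fin g → ℤ) :
    (fun i => (((fun i => m i + (α : ℤ) * m' i) i : ℤ) : ℂ)) =
      (fun i => (m i : ℂ)) + (α : ℂ) • fun i => (m' i : ℂ) := by
  funext i
  simp only [Pi.add_apply, Pi.smul_apply, smul_eq_mul]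
  push_cast
  ring

/-- **The general terms multiply according to Koizumi's reindexing** (Koizumi 1975 Thm. 2, proof:
"proved just by means of computation of the series"): with `r = m − βm′ + p`, `s = m + αm′`,
`T[a₁;b₁](αΩ, αx)(r) · T[a₂;b₂](βΩ, βy)(s)
 = T[(αa₁+βa₂+αp)/(α+β); b₁+b₂]((α+β)Ω, αx+βy)(m) · T[(a₂−a₁−p)/(α+β); αb₂−βb₁](αβ(α+β)Ω, αβ(y−x))(m′)`.
[cite: Koizumi1975GradedAlgebrasTheta, §2 Thm. 2 (2.a)] -/
theorem riemannThetaCharTerm_mul_riemannThetaCharTerm (Ω : Matrix (Fin g) (Fin g) ℂ)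
    {α β : ℕ} (hn : 0 < α + β) (a₁ b₁ a₂ b₂ x y : Fin g → ℂ) (p : Fin g → Fin (α + β))
    (m m' : Fin g → ℤ) :
    riemannThetaCharTerm a₁ b₁ ((α : ℂ) • Ω) ((α : ℂ) • x)
          (fun i => m i - (β : ℤ) * m' i + ((p i : ℕ) : ℤ)) *
        riemannThetaCharTerm a₂ b₂ ((β : ℂ) • Ω) ((β : ℂ) • y) (fun i => m i + (α : ℤ) * m' i) =
      riemannThetaCharTerm
          (((α + β : ℕ) : ℂ)⁻¹ • ((α : ℂ) • a₁ + (β : ℂ) • a₂ + (α : ℂ) • fun i => ((p i : ℕ) : ℂ)))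
          (b₁ + b₂) (((α + β : ℕ) : ℂ) • Ω) ((α : ℂ) • x + (β : ℂ) • y) m *
        riemannThetaCharTerm (((α + β : ℕ) : ℂ)⁻¹ • (a₂ - a₁ - fun i => ((p i : ℕ) : ℂ)))
          ((α : ℂ) • b₂ - (β : ℂ) • b₁) (((α : ℂ) * β * ((α + β : ℕ) : ℂ)) • Ω)
          (((α : ℂ) * β) • (y - x)) m' := by
  have hN0 : ((α + β : ℕ) : ℂ) ≠ 0 := by exact_mod_cast hn.ne'
  have hN : ((α + β : ℕ) : ℂ) = (α : ℂ) + (β : ℂ) := by push_cast; ring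
  simp only [riemannThetaCharTerm, ← Complex.exp_add]
  congr 1
  rw [intCast_vec_mulIndex₁, intCast_vec_mulIndex₂]
  set N : ℂ := ((α + β : ℕ) : ℂ) with hNdef
  set M : Fin g → ℂ := fun i => (m i : ℂ)
  set M' : Fin g → ℂ := fun i => (m' i : ℂ)
  set P : Fin g → ℂ := fun i => ((p i : ℕ) : ℂ)
  set U : Fin g → ℂ := M - (β : ℂ) • M' + P + a₁ with hU
  set V : Fin g → ℂ := M + (α : ℂ) • M' + a₂ with hV
  have hW : M + N⁻¹ • ((α : ℂ) • a₁ + (β : ℂ) • a₂ + (α : ℂ) • P) =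
      N⁻¹ • ((α : ℂ) • U + (β : ℂ) • V) := by
    funext i
    simp only [hU, hV, Pi.add_apply, Pi.sub_apply, Pi.smul_apply, smul_eq_mul]
    field_simp
    rw [hN]
    ring
  have hD : M' + N⁻¹ • (a₂ - a₁ - P) = N⁻¹ • (V - U) := by
    funext i
    simp only [hU, hV, Pi.add_apply, Pi.sub_apply, Pi.smul_apply, smul_eq_mul]
    field_simp
    rw [hN]
    ring
  rw [hW, hD]
  have q := dotProduct_mulVec_weighted_add_weighted_sub Ω U V (α : ℂ) (β : ℂ)
  have l := dotProduct_weighted_add_weighted_sub U V x y b₁ b₂ (α : ℂ) (β : ℂ)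
  rw [← hN] at q l
  have hinv : N⁻¹ * N = 1 := inv_mul_cancel₀ hN0
  simp only [smul_dotProduct, dotProduct_smul, Matrix.mulVec_smul, Matrix.smul_mulVec,
    smul_eq_mul]
  linear_combination (-(↑π * I * N⁻¹ * N⁻¹ * N)) * q + (-(2 * ↑π * I * N⁻¹)) * l +
    (-(↑π * I) * (N⁻¹ * N + 1) * ((α : ℂ) * (U ⬝ᵥ (Ω *ᵥ U)) + (β : ℂ) * (V ⬝ᵥ (Ω *ᵥ V))) -
      2 * ↑π * I * (U ⬝ᵥ ((α : ℂ) • x + b₁) + V ⬝ᵥ ((β : ℂ) • y + b₂))) * hinv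

/-! ### §4 Convergence at rescaled period matrices; the abstract reindexing step -/

/-- `kΩ` is symmetric when `Ω` is. [folklore] -/
private theorem smul_symm_of_symm (Ω : Matrix (Fin g) (Fin g) ℂ) (hΩ : ∀ i j, Ω i j = Ω j i) (k : ℂ) :
    ∀ i j, (k • Ω) i j = (k • Ω) j i := fun i j => by
  simp only [Matrix.smul_apply, hΩ i j]

/-- `Im(kΩ) ≥ (Re k)·c` as quadratic forms when `Im Ω ≥ c` and `k` is a non-negative real scalar
(the convergence hypothesis of Prop. 3.3.6 at the period matrix `kΩ ∈ ℌ_g`).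
[cite: LangeBirkenhake1992, §3.3.2 Prop. 3.3.6] -/
theorem smul_im_bound (Ω : Matrix (Fin g) (Fin g) ℂ) {c : ℝ}
    (hY : ∀ x : Fin g → ℝ, c * ∑ i, x i ^ 2 ≤ ∑ i, ∑ j, x i * (Ω i j).im * x j)
    {k : ℂ} (hk : k.im = 0) (hk0 : 0 ≤ k.re) (x : Fin g → ℝ) :
    k.re * c * ∑ i, x i ^ 2 ≤ ∑ i, ∑ j, x i * ((k • Ω) i j).im * x j := by
  have e : ∑ i, ∑ j, x i * ((k • Ω) i j).im * x j =
      k.re * ∑ i, ∑ j, x i * (Ω i j).im * x j := by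
    rw [Finset.mul_sum]
    refine Finset.sum_congr rfl fun i _ => ?_
    rw [Finset.mul_sum]
    refine Finset.sum_congr rfl fun j _ => ?_
    simp only [Matrix.smul_apply, smul_eq_mul, Complex.mul_im, hk, zero_mul, add_zero]
    ring
  rw [e, mul_assoc]
  exact mul_le_mul_of_nonneg_left (hY x) hk0

/-- **Absolute convergence of `ϑ[a; b](·, kΩ)`** for a positive real scalar `k` (so that
`Im(kΩ) ≥ kc > 0`). [cite: LangeBirkenhake1992, §3.3.2 Prop. 3.3.6] -/
theorem summable_norm_riemannThetaCharTerm_smul (Ω : Matrix (Fin g) (Fin g) ℂ)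
    (hΩ : ∀ i j, Ω i j = Ω j i) {c : ℝ} (hc : 0 < c)
    (hY : ∀ x : Fin g → ℝ, c * ∑ i, x i ^ 2 ≤ ∑ i, ∑ j, x i * (Ω i j).im * x j)
    {k : ℂ} (hk : k.im = 0) (hk0 : 0 < k.re) (a b z : Fin g → ℂ) :
    Summable fun m : Fin g → ℤ => ‖riemannThetaCharTerm a b (k • Ω) z m‖ :=
  summable_norm_riemannThetaCharTerm (k • Ω) (smul_symm_of_symm Ω hΩ k) (mul_pos hk0 hc)
    (smul_im_bound Ω hY hk hk0.le) a b z

/-- **The reindexing step, abstractly**: if two absolutely convergent series over `ℤ^g` multiply,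
after a reindexing `e : ι × ℤ^g × ℤ^g ≃ ℤ^g × ℤ^g` with finite `ι`, into products of terms of
convergent series `G p`, `H p`, then `(Σ T₁)(Σ T₂) = Σ_p (Σ G p)(Σ H p)`. [folklore] -/
private theorem tsum_mul_tsum_eq_sum_of_reindex {ι : Type*} [Fintype ι]
    (T₁ T₂ : (Fin g → ℤ) → ℂ) (G H : ι → (Fin g → ℤ) → ℂ)
    (e : ι × (Fin g → ℤ) × (Fin g → ℤ) ≃ (Fin g → ℤ) × (Fin g → ℤ))
    (hfac : ∀ x, T₁ (e x).1 * T₂ (e x).2 = G x.1 x.2.1 * H x.1 x.2.2)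
    (hT₁ : Summable fun m => ‖T₁ m‖) (hT₂ : Summable fun m => ‖T₂ m‖)
    (hG : ∀ p, Summable (G p)) (hH : ∀ p, Summable (H p)) :
    (∑' m, T₁ m) * (∑' m, T₂ m) = ∑ p, (∑' m, G p m) * (∑' m, H p m) := by
  rw [tsum_mul_tsum_of_summable_norm hT₁ hT₂, ← e.tsum_eq]
  have hPn : Summable fun x : (Fin g → ℤ) × (Fin g → ℤ) => ‖T₁ x.1 * T₂ x.2‖ :=
    Summable.mul_norm hT₁ hT₂
  have hFs : Summable fun x : ι × (Fin g → ℤ) × (Fin g → ℤ) => G x.1 x.2.1 * H x.1 x.2.2 :=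
    ((e.summable_iff (f := fun x : (Fin g → ℤ) × (Fin g → ℤ) => T₁ x.1 * T₂ x.2)).mpr
      hPn.of_norm).congr hfac
  rw [tsum_congr hfac, hFs.tsum_prod' (fun p => hFs.prod_factor p), tsum_fintype]
  refine Finset.sum_congr rfl fun p _ => ?_
  exact ((hG p).tsum_mul_tsum (hH p) (hFs.prod_factor p)).symm

/-- **The reindexing step for one series**: `Σ_m T(m) = Σ_c Σ_m G c m` after a reindexing
`e : ι × ℤ^g ≃ ℤ^g` with finite `ι`. [folklore] -/
private theorem tsum_eq_sum_tsum_of_reindex {ι : Type*} [Fintype ι]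
    (T : (Fin g → ℤ) → ℂ) (G : ι → (Fin g → ℤ) → ℂ) (e : ι × (Fin g → ℤ) ≃ (Fin g → ℤ))
    (hfac : ∀ x, T (e x) = G x.1 x.2) (hT : Summable T) :
    ∑' m, T m = ∑ c, ∑' m, G c m := by
  rw [← e.tsum_eq]
  have hF : Summable fun x : ι × (Fin g → ℤ) => G x.1 x.2 :=
    ((e.summable_iff (f := T)).mpr hT).congr hfac
  rw [tsum_congr hfac, hF.tsum_prod' (fun c => hF.prod_factor c), tsum_fintype]

/-! ### §5 The multiplication formula (Koizumi (2.a) at `γ = 1`) -/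

/-- Real scalars `α`, `αβ(α+β)` used below: imaginary part `0`, real part as expected. [folklore] -/
private theorem natCast_mul_re_im (α β : ℕ) :
    ((α : ℂ) * β * ((α + β : ℕ) : ℂ)).im = 0 ∧
      ((α : ℂ) * β * ((α + β : ℕ) : ℂ)).re = (α : ℝ) * β * ((α + β : ℕ) : ℝ) := by
  constructor
  · simp [Complex.mul_im, Complex.mul_re]
  · simp [Complex.mul_re, Complex.mul_im]

/-- **Koizumi's generalized addition formula (Theorem 2 (2.a), `γ = 1`), for all complex
characteristics and arguments**: for `Ω` symmetric with `Im Ω > 0`, positive integers `α, β` and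
`a₁, b₁, a₂, b₂, x, y ∈ ℂ^g`,
`ϑ[a₁; b₁](αΩ, αx) · ϑ[a₂; b₂](βΩ, βy)
  = Σ_{p ∈ {0,…,α+β−1}^g} ϑ[(αa₁ + βa₂ + αp)/(α+β); b₁ + b₂]((α+β)Ω, αx + βy)
      · ϑ[(a₂ − a₁ − p)/(α+β); αb₂ − βb₁](αβ(α+β)Ω, αβ(y − x))`
(printed with `k⁽ⁱ⁾ = (aᵢ; bᵢ)`, `p₁ = p/(α+β) ∈ U_{α+β}`, "`+ αp₁`", "`− p₁`").
[cite: Koizumi1975GradedAlgebrasTheta, §2 Thm. 2 (2.a)] [cite: Koizumi1976ThetaRelations, §2] -/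
theorem riemannThetaChar_mul_riemannThetaChar (Ω : Matrix (Fin g) (Fin g) ℂ)
    (hΩ : ∀ i j, Ω i j = Ω j i) {c : ℝ} (hc : 0 < c)
    (hY : ∀ x : Fin g → ℝ, c * ∑ i, x i ^ 2 ≤ ∑ i, ∑ j, x i * (Ω i j).im * x j)
    {α β : ℕ} (hα : 0 < α) (hβ : 0 < β) (a₁ b₁ a₂ b₂ x y : Fin g → ℂ) :
    riemannThetaChar a₁ b₁ ((α : ℂ) • Ω) ((α : ℂ) • x) *
        riemannThetaChar a₂ b₂ ((β : ℂ) • Ω) ((β : ℂ) • y) =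
      ∑ p : Fin g → Fin (α + β),
        riemannThetaChar
            (((α + β : ℕ) : ℂ)⁻¹ • ((α : ℂ) • a₁ + (β : ℂ) • a₂ + (α : ℂ) • fun i => ((p i : ℕ) : ℂ)))
            (b₁ + b₂) (((α + β : ℕ) : ℂ) • Ω) ((α : ℂ) • x + (β : ℂ) • y) *
          riemannThetaChar (((α + β : ℕ) : ℂ)⁻¹ • (a₂ - a₁ - fun i => ((p i : ℕ) : ℂ)))
            ((α : ℂ) • b₂ - (β : ℂ) • b₁) (((α : ℂ) * β * ((α + β : ℕ) : ℂ)) • Ω)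
            (((α : ℂ) * β) • (y - x)) := by
  have hn : 0 < α + β := by omega
  have hS := fun (k : ℂ) (hk : k.im = 0) (hk0 : 0 < k.re) (a b z : Fin g → ℂ) =>
    summable_norm_riemannThetaCharTerm_smul Ω hΩ hc hY hk hk0 a b z
  have hαi : ((α : ℂ)).im = 0 := Complex.natCast_im α
  have hαr : 0 < ((α : ℂ)).re := by rw [Complex.natCast_re]; exact_mod_cast hα
  have hβi : ((β : ℂ)).im = 0 := Complex.natCast_im β
  have hβr : 0 < ((β : ℂ)).re := by rw [Complex.natCast_re]; exact_mod_cast hβ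
  have hNi : (((α + β : ℕ) : ℂ)).im = 0 := Complex.natCast_im _
  have hNr : 0 < (((α + β : ℕ) : ℂ)).re := by rw [Complex.natCast_re]; exact_mod_cast hn
  obtain ⟨hKi, hKr'⟩ := natCast_mul_re_im α β
  have hKr : 0 < ((α : ℂ) * β * ((α + β : ℕ) : ℂ)).re := by
    rw [hKr']
    have : (0 : ℝ) < α := by exact_mod_cast hα
    have : (0 : ℝ) < β := by exact_mod_cast hβ
    have : (0 : ℝ) < ((α + β : ℕ) : ℝ) := by exact_mod_cast hn
    positivity
  set N : ℂ := ((α + β : ℕ) : ℂ) with hN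
  set K : ℂ := (α : ℂ) * β * N with hK
  set e := Equiv.ofBijective _ (mulIndex_bijective g hn) with he
  have hfac : ∀ q : (Fin g → Fin (α + β)) × (Fin g → ℤ) × (Fin g → ℤ),
      riemannThetaCharTerm a₁ b₁ ((α : ℂ) • Ω) ((α : ℂ) • x) (e q).1 *
          riemannThetaCharTerm a₂ b₂ ((β : ℂ) • Ω) ((β : ℂ) • y) (e q).2 =
        riemannThetaCharTerm
            (N⁻¹ • ((α : ℂ) • a₁ + (β : ℂ) • a₂ + (α : ℂ) • fun i => ((q.1 i : ℕ) : ℂ)))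
            (b₁ + b₂) (N • Ω) ((α : ℂ) • x + (β : ℂ) • y) q.2.1 *
          riemannThetaCharTerm (N⁻¹ • (a₂ - a₁ - fun i => ((q.1 i : ℕ) : ℂ)))
            ((α : ℂ) • b₂ - (β : ℂ) • b₁) (K • Ω) (((α : ℂ) * β) • (y - x)) q.2.2 := by
    rintro ⟨p, m, m'⟩
    rw [he, Equiv.ofBijective_apply]
    exact riemannThetaCharTerm_mul_riemannThetaCharTerm Ω hn a₁ b₁ a₂ b₂ x y p m m'
  have key := tsum_mul_tsum_eq_sum_of_reindex
    (riemannThetaCharTerm a₁ b₁ ((α : ℂ) • Ω) ((α : ℂ) • x))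
    (riemannThetaCharTerm a₂ b₂ ((β : ℂ) • Ω) ((β : ℂ) • y))
    (fun (p : Fin g → Fin (α + β)) (m : Fin g → ℤ) => riemannThetaCharTerm
      (N⁻¹ • ((α : ℂ) • a₁ + (β : ℂ) • a₂ + (α : ℂ) • fun i => ((p i : ℕ) : ℂ)))
      (b₁ + b₂) (N • Ω) ((α : ℂ) • x + (β : ℂ) • y) m)
    (fun (p : Fin g → Fin (α + β)) (m' : Fin g → ℤ) => riemannThetaCharTerm (N⁻¹ • (a₂ - a₁ - fun i => ((p i : ℕ) : ℂ)))
      ((α : ℂ) • b₂ - (β : ℂ) • b₁) (K • Ω) (((α : ℂ) * β) • (y - x)) m')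
    e hfac (hS _ hαi hαr a₁ b₁ _) (hS _ hβi hβr a₂ b₂ _)
    (fun p => (hS _ hNi hNr _ _ _).of_norm) (fun p => (hS _ hKi hKr _ _ _).of_norm)
  simpa only [riemannThetaChar_def] using key

/-! ### §6 Level raising (the inner sum over `c₁ ∈ U_γ` in Koizumi's (2.a)) -/

/-- **`(k, m) ↦ γm + k` is a bijection `{0,…,γ−1}^g × ℤ^g ≃ ℤ^g`** (Euclidean division).
[folklore] -/
private theorem levelIndex_bijective (g : ℕ) {γ : ℕ} (hγ : 0 < γ) :
    Function.Bijective (fun x : (Fin g → Fin γ) × (Fin g → ℤ) =>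
      (fun i => (γ : ℤ) * x.2 i + ((x.1 i : ℕ) : ℤ) : Fin g → ℤ)) := by
  have hγ0 : (0 : ℤ) < (γ : ℤ) := by exact_mod_cast hγ
  have hγne : (γ : ℤ) ≠ 0 := hγ0.ne'
  refine Function.bijective_iff_has_inverse.mpr
    ⟨fun m => (fun i => ⟨(m i % (γ : ℤ)).toNat, ?_⟩, fun i => m i / (γ : ℤ)), ?_, ?_⟩
  · have h0 := Int.emod_nonneg (m i) hγne
    have h1 := Int.emod_lt_of_pos (m i) hγ0
    omega
  · rintro ⟨k, m⟩
    have hk : ∀ i, (0 : ℤ) ≤ ((k i : ℕ) : ℤ) ∧ ((k i : ℕ) : ℤ) < (γ : ℤ) := fun i =>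
      ⟨by positivity, by exact_mod_cast (k i).isLt⟩
    have hdiv : ∀ i, ((γ : ℤ) * m i + ((k i : ℕ) : ℤ)) / (γ : ℤ) = m i := by
      intro i
      rw [add_comm, Int.add_mul_ediv_left _ _ hγne, Int.ediv_eq_zero_of_lt (hk i).1 (hk i).2,
        zero_add]
    have hmod : ∀ i, ((γ : ℤ) * m i + ((k i : ℕ) : ℤ)) % (γ : ℤ) = ((k i : ℕ) : ℤ) := by
      intro i
      rw [add_comm, Int.add_mul_emod_self_left, Int.emod_eq_of_lt (hk i).1 (hk i).2]
    simp only [Prod.mk.injEq]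
    exact ⟨funext fun i => Fin.ext (by simp only [hmod i, Int.toNat_natCast]),
      funext fun i => hdiv i⟩
  · intro m
    funext i
    dsimp only
    have h0 := Int.emod_nonneg (m i) hγne
    have h := Int.mul_ediv_add_emod (m i) (γ : ℤ)
    rw [Int.toNat_of_nonneg h0]
    exact h

/-- **Termwise level raising**: with `m = γm′ + k`,
`T[a; b](Ω, z)(m) = T[(a + k)/γ; γb](γ²Ω, γz)(m′)`. [cite: Koizumi1975GradedAlgebrasTheta, §2 Thm. 2 (2.a)] -/
theorem riemannThetaCharTerm_level (Ω : Matrix (Fin g) (Fin g) ℂ) {γ : ℕ} (hγ : 0 < γ)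
    (a b z : Fin g → ℂ) (k : Fin g → Fin γ) (m : Fin g → ℤ) :
    riemannThetaCharTerm a b Ω z (fun i => (γ : ℤ) * m i + ((k i : ℕ) : ℤ)) =
      riemannThetaCharTerm ((γ : ℂ)⁻¹ • (a + fun i => ((k i : ℕ) : ℂ))) ((γ : ℂ) • b)
        (((γ : ℂ) ^ 2) • Ω) ((γ : ℂ) • z) m := by
  have hγ0 : (γ : ℂ) ≠ 0 := by exact_mod_cast hγ.ne'
  simp only [riemannThetaCharTerm]
  congr 1
  have hcast : (fun i => (((fun i => (γ : ℤ) * m i + ((k i : ℕ) : ℤ)) i : ℤ) : ℂ)) =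
      (γ : ℂ) • (fun i => (m i : ℂ)) + fun i => ((k i : ℕ) : ℂ) := by
    funext i
    simp only [Pi.add_apply, Pi.smul_apply, smul_eq_mul]
    push_cast
    ring
  rw [hcast]
  set M : Fin g → ℂ := fun i => (m i : ℂ)
  set C : Fin g → ℂ := fun i => ((k i : ℕ) : ℂ)
  have hW : (γ : ℂ) • M + C + a = (γ : ℂ) • (M + (γ : ℂ)⁻¹ • (a + C)) := by
    funext i
    simp only [Pi.add_apply, Pi.smul_apply, smul_eq_mul]
    field_simp
    ring
  rw [hW, ← smul_add]
  simp only [smul_dotProduct, dotProduct_smul, Matrix.mulVec_smul, Matrix.smul_mulVec,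
    smul_eq_mul]
  ring

/-- **Level raising (change of level by `γ`)**: for `Ω` symmetric with `Im Ω > 0` and `γ ≥ 1`,
`ϑ[a; b](Ω, z) = Σ_{k ∈ {0,…,γ−1}^g} ϑ[(a + k)/γ; γb](γ²Ω, γz)` — splitting the summation over
`ℤ^g` into the classes mod `γ`; this is the inner sum "`Σ_{c₁ ∈ U_γ} θ[(…)/γ + c₁; γ(…)](γ²(…)z | γ(…))`"
of Koizumi's (2.a). [cite: Koizumi1975GradedAlgebrasTheta, §2 Thm. 2 (2.a)]
[cite: MumfordTata1, Ch. II §1] -/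
theorem riemannThetaChar_eq_sum_level (Ω : Matrix (Fin g) (Fin g) ℂ)
    (hΩ : ∀ i j, Ω i j = Ω j i) {c : ℝ} (hc : 0 < c)
    (hY : ∀ x : Fin g → ℝ, c * ∑ i, x i ^ 2 ≤ ∑ i, ∑ j, x i * (Ω i j).im * x j)
    {γ : ℕ} (hγ : 0 < γ) (a b z : Fin g → ℂ) :
    riemannThetaChar a b Ω z =
      ∑ k : Fin g → Fin γ, riemannThetaChar ((γ : ℂ)⁻¹ • (a + fun i => ((k i : ℕ) : ℂ)))
        ((γ : ℂ) • b) (((γ : ℂ) ^ 2) • Ω) ((γ : ℂ) • z) := by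
  set e := Equiv.ofBijective _ (levelIndex_bijective g hγ) with he
  have hfac : ∀ q : (Fin g → Fin γ) × (Fin g → ℤ),
      riemannThetaCharTerm a b Ω z (e q) =
        riemannThetaCharTerm ((γ : ℂ)⁻¹ • (a + fun i => ((q.1 i : ℕ) : ℂ))) ((γ : ℂ) • b)
          (((γ : ℂ) ^ 2) • Ω) ((γ : ℂ) • z) q.2 := by
    rintro ⟨k, m⟩
    rw [he, Equiv.ofBijective_apply]
    exact riemannThetaCharTerm_level Ω hγ a b z k m
  have key := tsum_eq_sum_tsum_of_reindex (riemannThetaCharTerm a b Ω z)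
    (fun (k : Fin g → Fin γ) (m : Fin g → ℤ) =>
      riemannThetaCharTerm ((γ : ℂ)⁻¹ • (a + fun i => ((k i : ℕ) : ℂ))) ((γ : ℂ) • b)
        (((γ : ℂ) ^ 2) • Ω) ((γ : ℂ) • z) m)
    e hfac (summable_riemannThetaCharTerm Ω hΩ hc hY a b z)
  simpa only [riemannThetaChar_def] using key

/-! ### §7 Koizumi's (2.b) as printed, and (2.a) with the level-raising sum -/

/-- **Koizumi's Corollary 2.1, formula (2.b), verbatim**: for `k = (k₁; k₂)`, positive integers
`α, β` and `a₁ ∈ U_{αe}`, `b₁ ∈ U_{βe}` (here: arbitrary complex vectors),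
`θ[k₁ + a₁; αk₂](αz | αx) · θ[k₁ + b₁; βk₂](βz | βx)
  = Σ_{p₁ ∈ U_{α+β}} θ[k₁ + (α+β)⁻¹(αa₁ + βb₁) + αp₁; (α+β)k₂]((α+β)z | (α+β)x)
      × θ[(α+β)⁻¹(−a₁ + b₁) − p₁; 0](αβ(α+β)z | 0)`,
with `p₁ = p/(α+β)`, `p ∈ {0,…,α+β−1}^g` — "We content ourselves with stating this formula (2.b) as
an answer to the question (b)" (the multiplication table of the canonical bases).
[cite: Koizumi1975GradedAlgebrasTheta, §2 Cor. 2.1 (2.b)] [cite: Koizumi1976ThetaRelations, §2] -/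
theorem riemannThetaChar_mul_riemannThetaChar_koizumi (Ω : Matrix (Fin g) (Fin g) ℂ)
    (hΩ : ∀ i j, Ω i j = Ω j i) {c : ℝ} (hc : 0 < c)
    (hY : ∀ x : Fin g → ℝ, c * ∑ i, x i ^ 2 ≤ ∑ i, ∑ j, x i * (Ω i j).im * x j)
    {α β : ℕ} (hα : 0 < α) (hβ : 0 < β) (k₁ k₂ a₁ b₁ x : Fin g → ℂ) :
    riemannThetaChar (k₁ + a₁) ((α : ℂ) • k₂) ((α : ℂ) • Ω) ((α : ℂ) • x) *
        riemannThetaChar (k₁ + b₁) ((β : ℂ) • k₂) ((β : ℂ) • Ω) ((β : ℂ) • x) =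
      ∑ p : Fin g → Fin (α + β),
        riemannThetaChar
            (k₁ + ((α + β : ℕ) : ℂ)⁻¹ •
              ((α : ℂ) • a₁ + (β : ℂ) • b₁ + (α : ℂ) • fun i => ((p i : ℕ) : ℂ)))
            (((α + β : ℕ) : ℂ) • k₂) (((α + β : ℕ) : ℂ) • Ω) (((α + β : ℕ) : ℂ) • x) *
          riemannThetaChar (((α + β : ℕ) : ℂ)⁻¹ • (b₁ - a₁ - fun i => ((p i : ℕ) : ℂ))) 0
            (((α : ℂ) * β * ((α + β : ℕ) : ℂ)) • Ω) 0 := by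
  have hn : 0 < α + β := by omega
  have hN0 : ((α + β : ℕ) : ℂ) ≠ 0 := by exact_mod_cast hn.ne'
  have hN : ((α + β : ℕ) : ℂ) = (α : ℂ) + (β : ℂ) := by push_cast; ring
  rw [riemannThetaChar_mul_riemannThetaChar Ω hΩ hc hY hα hβ]
  refine Finset.sum_congr rfl fun p _ => ?_
  have e1 : ((α + β : ℕ) : ℂ)⁻¹ •
        ((α : ℂ) • (k₁ + a₁) + (β : ℂ) • (k₁ + b₁) + (α : ℂ) • fun i => ((p i : ℕ) : ℂ)) =
      k₁ + ((α + β : ℕ) : ℂ)⁻¹ •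
        ((α : ℂ) • a₁ + (β : ℂ) • b₁ + (α : ℂ) • fun i => ((p i : ℕ) : ℂ)) := by
    funext i
    simp only [Pi.add_apply, Pi.smul_apply, smul_eq_mul]
    field_simp
    rw [hN]
    ring
  have e2 : (α : ℂ) • k₂ + (β : ℂ) • k₂ = ((α + β : ℕ) : ℂ) • k₂ := by rw [hN, add_smul]
  have e3 : (α : ℂ) • x + (β : ℂ) • x = ((α + β : ℕ) : ℂ) • x := by rw [hN, add_smul]
  have e4 : ((α + β : ℕ) : ℂ)⁻¹ • (k₁ + b₁ - (k₁ + a₁) - fun i => ((p i : ℕ) : ℂ)) =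
      ((α + β : ℕ) : ℂ)⁻¹ • (b₁ - a₁ - fun i => ((p i : ℕ) : ℂ)) := by
    congr 1
    abel
  have e5 : (α : ℂ) • ((β : ℂ) • k₂) - (β : ℂ) • ((α : ℂ) • k₂) = 0 := by
    rw [smul_smul, smul_smul, mul_comm, sub_self]
  have e6 : ((α : ℂ) * β) • (x - x) = (0 : Fin g → ℂ) := by rw [sub_self, smul_zero]
  rw [e1, e2, e3, e4, e5, e6]

/-- **Koizumi's Theorem 2, formula (2.a), with the sum over `c₁ ∈ U_γ`** (`γ ≥ 1`; the printed
hypothesis "`α` is divisible by `γ`" is not needed for the identity itself):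
`ϑ[a₁; b₁](αΩ, αx) · ϑ[a₂; b₂](βΩ, βy) = Σ_p { Σ_k ϑ[((αa₁+βa₂+αp)/(α+β) + k)/γ; γ(b₁+b₂)]
(γ²(α+β)Ω, γ(αx+βy)) } · ϑ[(a₂ − a₁ − p)/(α+β); αb₂ − βb₁](αβ(α+β)Ω, αβ(y−x))`.
[cite: Koizumi1975GradedAlgebrasTheta, §2 Thm. 2 (2.a)] [cite: Koizumi1976ThetaRelations, §2] -/
theorem riemannThetaChar_mul_riemannThetaChar_level (Ω : Matrix (Fin g) (Fin g) ℂ)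
    (hΩ : ∀ i j, Ω i j = Ω j i) {c : ℝ} (hc : 0 < c)
    (hY : ∀ x : Fin g → ℝ, c * ∑ i, x i ^ 2 ≤ ∑ i, ∑ j, x i * (Ω i j).im * x j)
    {α β γ : ℕ} (hα : 0 < α) (hβ : 0 < β) (hγ : 0 < γ) (a₁ b₁ a₂ b₂ x y : Fin g → ℂ) :
    riemannThetaChar a₁ b₁ ((α : ℂ) • Ω) ((α : ℂ) • x) *
        riemannThetaChar a₂ b₂ ((β : ℂ) • Ω) ((β : ℂ) • y) =
      ∑ p : Fin g → Fin (α + β),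
        (∑ k : Fin g → Fin γ,
          riemannThetaChar
            ((γ : ℂ)⁻¹ • ((((α + β : ℕ) : ℂ)⁻¹ •
                ((α : ℂ) • a₁ + (β : ℂ) • a₂ + (α : ℂ) • fun i => ((p i : ℕ) : ℂ))) +
              fun i => ((k i : ℕ) : ℂ)))
            ((γ : ℂ) • (b₁ + b₂)) (((γ : ℂ) ^ 2) • (((α + β : ℕ) : ℂ) • Ω))
            ((γ : ℂ) • ((α : ℂ) • x + (β : ℂ) • y))) *
          riemannThetaChar (((α + β : ℕ) : ℂ)⁻¹ • (a₂ - a₁ - fun i => ((p i : ℕ) : ℂ)))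
            ((α : ℂ) • b₂ - (β : ℂ) • b₁) (((α : ℂ) * β * ((α + β : ℕ) : ℂ)) • Ω)
            (((α : ℂ) * β) • (y - x)) := by
  have hn : 0 < α + β := by omega
  have hNi : (((α + β : ℕ) : ℂ)).im = 0 := Complex.natCast_im _
  have hNr : 0 < (((α + β : ℕ) : ℂ)).re := by rw [Complex.natCast_re]; exact_mod_cast hn
  rw [riemannThetaChar_mul_riemannThetaChar Ω hΩ hc hY hα hβ]
  refine Finset.sum_congr rfl fun p _ => ?_
  congr 1
  exact riemannThetaChar_eq_sum_level _ (smul_symm_of_symm Ω hΩ _) (mul_pos hNr hc)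
    (smul_im_bound Ω hY hNi hNr.le) hγ _ _ _

end Literature.Analysis.SpecialFunctions
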